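import Literature.Algebra.EuclideanLattices.GaussianLatticeTails
import Mathlib.Analysis.InnerProductSpace.ProdL2
import HarnessLib

/-!
# Regev 2009, Claim 3.13: the truncated periodic Gaussian state is exponentially close to the full one

Topic `Algebra/EuclideanLattices` (family `pqc`). Serves the decomposition of the named fact
`Literature.Computability.Cryptography.regev_lwe_to_sivp_quantum` (pqc.S19; Regev, J. ACM 56 (2009),
Thm 1.1), namely the QUANTUM half of the iterative step (Lemma 3.14, "second part of iterative step":
from a `CVP_{L*,d}` oracle to a `D_{L,√n/(√2 d)}` sample), whose two approximation steps ("this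
state is exponentially close to the required state", before and after the quantum Fourier transform)
both invoke

**Claim 3.13** (Regev 2009, p. 19; author's version arXiv:2401.03703, with the 2023 correction of
its proof). *Let `R ≥ 1` be an integer and `L` an `n`-dimensional lattice. Then the `ℓ₂` distance
between the normalized quantum states corresponding to
`|ϑ₁⟩ = ∑_{x ∈ L/R, ‖x‖ < √n} ρ(x) |x mod P(L)⟩` and
`|ϑ₂⟩ = ∑_{x ∈ L/R} ρ(x) |x mod P(L)⟩ = ∑_{x ∈ L/R ∩ P(L)} ∑_{y ∈ L} ρ(x - y) |x⟩` is `2^{-Ω(n)}`.*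
(The printed hypothesis `λ₁(L) > 2√n` "is no longer used in the proof", footnote p. 19.)

The printed proof (p. 20): with `Z = ‖ϑ₂‖`, the `2n`-dimensional lattice
`M = {(x₁, x₂) ∈ L/R × L/R | x₁ ≡ x₂ mod L}` has `ρ(M) = ∑_x ρ(x + L)² = Z²`;
`‖ϑ₂ - ϑ₁‖² = ρ(M')` for the pairs with both coordinates of norm `≥ √n`, and
`M' ⊆ M ∖ √(2n) B`, so Banaszczyk's Lemma 2.5 in dimension `2n` bounds it by `2^{-2n} ρ(M)`.

Everything here is PROVED; theorems only (plus two auxiliary lattice definitions with bodies). We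
formalise the claim for an arbitrary pair of full-rank lattices `L ≤ T` (`T` plays `L/R`) and an
arbitrary finite TRANSVERSAL `S` of `T/L` (`S` plays `L/R ∩ P(L)`; the coefficient of `|x⟩` only
depends on the coset `x + L`), in the tree's Gaussian-mass language (`gaussianMass`,
`DiscreteGaussian.lean`): the coefficient of `|x⟩` in `ϑ₂` is `ρ(x + L) = gaussianMass 1 (-x) L` and in
`ϑ₂ - ϑ₁` it is the tail mass `gaussianMass 1 (-x) (L ∖ B(-x, √n))`. The coupling lattice `M` lives in
the `ℓ₂` product `WithLp 2 (V × V)` (so that `ρ((x₁,x₂)) = ρ(x₁)ρ(x₂)`).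

## Main results

* `Regev2009.couplingLattice T L` — `M`, with `DiscreteTopology` and `IsZLattice` instances
  (`M ≤ T × T`, `M ⊇ L × L`).
* `Regev2009.gaussianMass_couplingLattice_eq` — `ρ(M) = ∑_{x ∈ S} ρ(x + L)²` (`= Z²`).
* `Regev2009.sum_sq_tailMass_le_gaussianMass_diff_ball` — `∑_{x ∈ S} ρ((x+L) ∖ √nB)² ≤ ρ(M ∖ √(2n) B)`.
* `Regev2009.claim_3_13` — **`∑_{x ∈ S} ρ((x+L) ∖ √n B)² ≤ 2^{-2n} ∑_{x ∈ S} ρ(x + L)²`**, i.e.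
  `‖ϑ₂ - ϑ₁‖ ≤ 2⁻ⁿ ‖ϑ₂‖` (`claim_3_13_real`, square roots taken).

## References

* O. Regev, *On lattices, learning with errors, random linear codes, and cryptography*, J. ACM 56
  (2009), art. 34; author's version arXiv:2401.03703 (2024), Claim 3.13 and its corrected proof
  (pp. 19–20), Lemma 3.14 [Regev2009].
* W. Banaszczyk, *New bounds in some transference theorems in the geometry of numbers*,
  Math. Ann. 296 (1993), Lemma 1.5(i) [Banaszczyk1993] (tree: `gaussianMass_diff_ball_le_holds`).
-/

noncomputable section

open Module Metric
open scoped ENNReal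

namespace Literature.Algebra.EuclideanLattices

namespace Regev2009

variable {V : Type*} [NormedAddCommGroup V]

/-! ### The Gaussian on the `ℓ₂` product `V × V` factors -/

/-- On the `ℓ₂` product, `ρ_s((x₁, x₂)) = ρ_s(x₁) ρ_s(x₂)`. [folklore] -/
theorem gaussianFunction_prod (s : ℝ) (w : WithLp 2 (V × V)) :
    gaussianFunction s w = gaussianFunction s w.fst * gaussianFunction s w.snd := by
  simp only [gaussianFunction, ← Real.exp_add, WithLp.prod_norm_sq_eq_of_L2]
  congr 1
  ring

/-- Norm comparison on the `ℓ₂` product: if both coordinates have norm `≥ a ≥ 0` then the pair has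
norm `≥ √2 · a`. [folklore] -/
theorem sqrt_two_mul_le_norm_of_le {a : ℝ} (ha : 0 ≤ a) (w : WithLp 2 (V × V))
    (h1 : a ≤ ‖w.fst‖) (h2 : a ≤ ‖w.snd‖) : Real.sqrt 2 * a ≤ ‖w‖ := by
  have hsq : (Real.sqrt 2 * a) ^ 2 ≤ ‖w‖ ^ 2 := by
    rw [WithLp.prod_norm_sq_eq_of_L2, mul_pow, Real.sq_sqrt zero_le_two]
    nlinarith [pow_le_pow_left₀ ha h1 2, pow_le_pow_left₀ ha h2 2]
  exact (pow_le_pow_iff_left₀ (by positivity) (norm_nonneg _) two_ne_zero).1 hsq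

/-! ### The coupling lattice `M` -/

/-- **The pairs lattice** `T × T` inside the `ℓ₂` product `V × V`. [folklore] -/
def pairLattice (T : Submodule ℤ V) : Submodule ℤ (WithLp 2 (V × V)) where
  carrier := {w | w.fst ∈ T ∧ w.snd ∈ T}
  add_mem' := by
    rintro a b ⟨ha1, ha2⟩ ⟨hb1, hb2⟩
    exact ⟨by rw [WithLp.add_fst]; exact T.add_mem ha1 hb1, by rw [WithLp.add_snd]; exact T.add_mem ha2 hb2⟩
  zero_mem' := ⟨T.zero_mem, T.zero_mem⟩
  smul_mem' := by
    rintro c w ⟨h1, h2⟩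
    exact ⟨by rw [WithLp.smul_fst]; exact T.smul_mem c h1, by rw [WithLp.smul_snd]; exact T.smul_mem c h2⟩

/-- **Regev's coupling lattice** `M = {(x₁, x₂) ∈ T × T | x₁ - x₂ ∈ L}` (proof of Claim 3.13, with
`T = L/R`), inside the `ℓ₂` product `V × V`. [cite: Regev2009, Claim 3.13 (proof)] -/
def couplingLattice (T L : Submodule ℤ V) : Submodule ℤ (WithLp 2 (V × V)) where
  carrier := {w | w.fst ∈ T ∧ w.snd ∈ T ∧ w.fst - w.snd ∈ L}
  add_mem' := by
    rintro a b ⟨ha1, ha2, ha3⟩ ⟨hb1, hb2, hb3⟩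
    refine ⟨by rw [WithLp.add_fst]; exact T.add_mem ha1 hb1, by rw [WithLp.add_snd]; exact T.add_mem ha2 hb2, ?_⟩
    rw [WithLp.add_fst, WithLp.add_snd, add_sub_add_comm]
    exact L.add_mem ha3 hb3
  zero_mem' := ⟨T.zero_mem, T.zero_mem, by simp⟩
  smul_mem' := by
    rintro c w ⟨h1, h2, h3⟩
    refine ⟨by rw [WithLp.smul_fst]; exact T.smul_mem c h1, by rw [WithLp.smul_snd]; exact T.smul_mem c h2, ?_⟩
    rw [WithLp.smul_fst, WithLp.smul_snd, ← smul_sub]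
    exact L.smul_mem c h3

/-- Membership in `M`. [folklore] -/
theorem mem_couplingLattice {T L : Submodule ℤ V} {w : WithLp 2 (V × V)} :
    w ∈ couplingLattice T L ↔ w.fst ∈ T ∧ w.snd ∈ T ∧ w.fst - w.snd ∈ L := Iff.rfl

/-- Membership in `T × T`. [folklore] -/
theorem mem_pairLattice {T : Submodule ℤ V} {w : WithLp 2 (V × V)} :
    w ∈ pairLattice T ↔ w.fst ∈ T ∧ w.snd ∈ T := Iff.rfl

/-- `M ≤ T × T`. [folklore] -/
theorem couplingLattice_le_pairLattice (T L : Submodule ℤ V) : couplingLattice T L ≤ pairLattice T :=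
  fun _ h => ⟨h.1, h.2.1⟩

/-- **`T × T` is discrete** when `T` is (a ball around `0` meeting `T` only in `0` gives one in the
product). [folklore] -/
instance instDiscreteTopologyPairLattice (T : Submodule ℤ V) [DiscreteTopology T] :
    DiscreteTopology (pairLattice T) := by
  -- an `ε`-ball around `0` in `V` meets `T` only in `0`
  obtain ⟨ε, hε, hball⟩ : ∃ ε > 0, ∀ t ∈ T, ‖t‖ < ε → t = 0 := by
    have hopen : IsOpen ({0} : Set T) := (discreteTopology_iff_isOpen_singleton_zero).1 inferInstance
    rw [Metric.isOpen_iff] at hopen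
    obtain ⟨ε, hε, hsub⟩ := hopen 0 (Set.mem_singleton 0)
    refine ⟨ε, hε, fun t ht hlt => ?_⟩
    have h := hsub (show (⟨t, ht⟩ : T) ∈ Metric.ball (0 : T) ε by
      rw [Metric.mem_ball, dist_zero_right]; exact hlt)
    rw [Set.mem_singleton_iff] at h
    exact congrArg Subtype.val h
  rw [discreteTopology_iff_isOpen_singleton_zero, Metric.isOpen_iff]
  intro w hw
  rw [Set.mem_singleton_iff] at hw
  subst hw
  refine ⟨ε, hε, fun w hwb => ?_⟩
  rw [Metric.mem_ball, dist_zero_right] at hwb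
  rw [Set.mem_singleton_iff]
  have hwn : ‖(w : WithLp 2 (V × V))‖ < ε := hwb
  have hsq := WithLp.prod_norm_sq_eq_of_L2 (w : WithLp 2 (V × V))
  have h1 : ‖(w : WithLp 2 (V × V)).fst‖ < ε :=
    lt_of_le_of_lt ((pow_le_pow_iff_left₀ (norm_nonneg _) (norm_nonneg _) two_ne_zero).1
      (by rw [hsq]; nlinarith [sq_nonneg ‖(w : WithLp 2 (V × V)).snd‖])) hwn
  have h2 : ‖(w : WithLp 2 (V × V)).snd‖ < ε :=
    lt_of_le_of_lt ((pow_le_pow_iff_left₀ (norm_nonneg _) (norm_nonneg _) two_ne_zero).1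
      (by rw [hsq]; nlinarith [sq_nonneg ‖(w : WithLp 2 (V × V)).fst‖])) hwn
  have e1 := hball _ w.2.1 h1
  have e2 := hball _ w.2.2 h2
  apply Subtype.ext
  change (w : WithLp 2 (V × V)) = 0
  have : (w : WithLp 2 (V × V)) = WithLp.toLp 2 ((w : WithLp 2 (V × V)).fst, (w : WithLp 2 (V × V)).snd) := rfl
  rw [this, e1, e2]
  rfl

/-- **`M` is discrete.** [folklore] -/
instance instDiscreteTopologyCouplingLattice (T L : Submodule ℤ V) [DiscreteTopology T] :
    DiscreteTopology (couplingLattice T L) :=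
  DiscreteTopology.of_subset (instDiscreteTopologyPairLattice T) (couplingLattice_le_pairLattice T L)

/-- **`M` is a full-rank lattice** (it contains `L × L`, whose real span is everything).
[cite: Regev2009, Claim 3.13 (proof: "the 2n-dimensional lattice M")] -/
instance instIsZLatticeCouplingLattice [NormedSpace ℝ V] [FiniteDimensional ℝ V] (T L : Submodule ℤ V)
    [DiscreteTopology T] [DiscreteTopology L] [IsZLattice ℝ L] [hLT : Fact (L ≤ T)] :
    IsZLattice ℝ (couplingLattice T L) := by
  refine ⟨eq_top_iff.2 fun w _ => ?_⟩
  have hL : Submodule.span ℝ (L : Set V) = ⊤ := IsZLattice.span_top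
  -- the two coordinate embeddings `V → V × V`
  let i1 : V →ₗ[ℝ] WithLp 2 (V × V) :=
    ((WithLp.linearEquiv 2 ℝ (V × V)).symm : (V × V) →ₗ[ℝ] WithLp 2 (V × V)) ∘ₗ LinearMap.inl ℝ V V
  let i2 : V →ₗ[ℝ] WithLp 2 (V × V) :=
    ((WithLp.linearEquiv 2 ℝ (V × V)).symm : (V × V) →ₗ[ℝ] WithLp 2 (V × V)) ∘ₗ LinearMap.inr ℝ V V
  have hsub1 : i1 '' (L : Set V) ⊆ (couplingLattice T L : Set (WithLp 2 (V × V))) := by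
    rintro _ ⟨y, hy, rfl⟩
    refine ⟨hLT.out hy, T.zero_mem, ?_⟩
    change y - 0 ∈ L
    rw [sub_zero]; exact hy
  have hsub2 : i2 '' (L : Set V) ⊆ (couplingLattice T L : Set (WithLp 2 (V × V))) := by
    rintro _ ⟨y, hy, rfl⟩
    refine ⟨T.zero_mem, hLT.out hy, ?_⟩
    change 0 - y ∈ L
    rw [zero_sub]; exact L.neg_mem hy
  have hw : w = i1 w.fst + i2 w.snd := by
    change w = WithLp.toLp 2 (w.fst, 0) + WithLp.toLp 2 (0, w.snd)
    rw [← WithLp.toLp_add, Prod.mk_add_mk, add_zero, zero_add]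
    rfl
  rw [hw]
  refine Submodule.add_mem _ ?_ ?_
  · have h : i1 w.fst ∈ Submodule.span ℝ (i1 '' (L : Set V)) := by
      rw [Submodule.span_image, hL, Submodule.map_top]
      exact ⟨w.fst, rfl⟩
    exact Submodule.span_mono hsub1 h
  · have h : i2 w.snd ∈ Submodule.span ℝ (i2 '' (L : Set V)) := by
      rw [Submodule.span_image, hL, Submodule.map_top]
      exact ⟨w.snd, rfl⟩
    exact Submodule.span_mono hsub2 h

/-! ### Gaussian masses of submodules as sums over the submodule -/

/-- The Gaussian mass of a submodule as a sum over its elements (definitional). [folklore] -/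
theorem gaussianMass_submodule {W : Type*} [NormedAddCommGroup W] (Λ : Submodule ℤ W) (s : ℝ) (c : W) :
    gaussianMass s c (Λ : Set W) = ∑' y : Λ, ENNReal.ofReal (gaussianFunction s ((y : W) - c)) := rfl

/-- The Gaussian mass of the part of a submodule inside a set, as an indicator sum over the
submodule. [folklore] -/
theorem gaussianMass_inter_eq_tsum_indicator {W : Type*} [NormedAddCommGroup W] (Λ : Submodule ℤ W)
    (P : Set W) (s : ℝ) (c : W) :
    gaussianMass s c ((Λ : Set W) ∩ P) =
      ∑' y : Λ, P.indicator (fun w => ENNReal.ofReal (gaussianFunction s (w - c))) y := by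
  rw [gaussianMass, tsum_subtype ((Λ : Set W) ∩ P) (fun w => ENNReal.ofReal (gaussianFunction s (w - c))),
    show (∑' y : Λ, P.indicator (fun w => ENNReal.ofReal (gaussianFunction s (w - c))) y) =
      ∑' y : (Λ : Set W), P.indicator (fun w => ENNReal.ofReal (gaussianFunction s (w - c))) y from rfl,
    tsum_subtype (Λ : Set W) (P.indicator fun w => ENNReal.ofReal (gaussianFunction s (w - c)))]
  refine tsum_congr fun w => ?_
  rw [Set.indicator_indicator]

/-! ### Transversals and the parametrisation `S × L × L ≃ M` -/

/-- `S` is a transversal of `T/L`: a finite set of elements of `T` meeting every coset of `L` in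
`T` exactly once (e.g. `L/R ∩ P(L)` for a basic parallelepiped `P(L)`, Regev 2009, Claim 3.13).
[cite: Regev2009, Claim 3.13] -/
structure IsTransversal (T L : Submodule ℤ V) (S : Finset V) : Prop where
  /-- representatives lie in `T` -/
  subset : ∀ x ∈ S, x ∈ T
  /-- every element of `T` has exactly one representative modulo `L` -/
  unique : ∀ t ∈ T, ∃! x, x ∈ S ∧ t - x ∈ L

namespace IsTransversal

variable {T L : Submodule ℤ V} {S : Finset V} (hS : IsTransversal T L S)
include hS

/-- The parametrisation of `M` by `S × L × L`: `(x, y₁, y₂) ↦ (x + y₁, x + y₂)`. [cite: Regev2009, Claim 3.13 (proof: "the union is of disjoint sets")] -/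
def param (hLT : L ≤ T) (q : S × L × L) : ((couplingLattice T L : Set (WithLp 2 (V × V))) : Type _) :=
  ⟨WithLp.toLp 2 ((q.1 : V) + q.2.1, (q.1 : V) + q.2.2), by
    refine ⟨T.add_mem (hS.subset _ q.1.2) (hLT q.2.1.2), T.add_mem (hS.subset _ q.1.2) (hLT q.2.2.2), ?_⟩
    change ((q.1 : V) + q.2.1) - ((q.1 : V) + q.2.2) ∈ L
    rw [add_sub_add_left_eq_sub]
    exact L.sub_mem q.2.1.2 q.2.2.2⟩

/-- Value of `param`. [folklore] -/
@[simp] theorem param_val (hLT : L ≤ T) (q : S × L × L) :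
    ((hS.param hLT q) : WithLp 2 (V × V)) = WithLp.toLp 2 ((q.1 : V) + q.2.1, (q.1 : V) + q.2.2) := rfl

/-- **The parametrisation is a bijection** `S × L × L ≃ M`. [cite: Regev2009, Claim 3.13 (proof: "the union is of disjoint sets")] -/
theorem param_bijective (hLT : L ≤ T) : Function.Bijective (hS.param hLT) := by
  constructor
  · rintro ⟨x, y1, y2⟩ ⟨x', y1', y2'⟩ h
    have h' := congrArg (fun m : ((couplingLattice T L : Set (WithLp 2 (V × V))) : Type _) => (m : WithLp 2 (V × V))) h
    simp only [param_val] at h'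
    have e1 : (x : V) + y1 = x' + y1' := by simpa using congrArg WithLp.fst h'
    have e2 : (x : V) + y2 = x' + y2' := by simpa using congrArg WithLp.snd h'
    -- the common element `t = x + y2 = x' + y2'` of `T` has a unique representative
    have ht : (x : V) + y2 ∈ T := T.add_mem (hS.subset _ x.2) (hLT y2.2)
    obtain ⟨z, -, hz⟩ := hS.unique _ ht
    have hx : (x : V) = z := hz x ⟨x.2, by rw [add_sub_cancel_left]; exact y2.2⟩
    have hx' : (x' : V) = z := hz x' ⟨x'.2, by rw [e2, add_sub_cancel_left]; exact y2'.2⟩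
    have hxx : (x : V) = x' := hx.trans hx'.symm
    have hy1 : (y1 : V) = y1' := by rw [hxx] at e1; exact add_left_cancel e1
    have hy2 : (y2 : V) = y2' := by rw [hxx] at e2; exact add_left_cancel e2
    exact Prod.ext (Subtype.ext hxx) (Prod.ext (Subtype.ext hy1) (Subtype.ext hy2))
  · rintro ⟨w, hw1, hw2, hw3⟩
    obtain ⟨x, ⟨hxS, hx⟩, -⟩ := hS.unique _ hw2
    refine ⟨(⟨x, hxS⟩, ⟨w.fst - x, ?_⟩, ⟨w.snd - x, hx⟩), ?_⟩
    · have : w.fst - x = (w.fst - w.snd) + (w.snd - x) := by abel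
      rw [this]; exact L.add_mem hw3 hx
    · apply Subtype.ext
      simp only [param_val, add_sub_cancel]
      rfl

/-- The parametrisation as an equivalence. [folklore] -/
def paramEquiv (hLT : L ≤ T) : (S × L × L) ≃ ((couplingLattice T L : Set (WithLp 2 (V × V))) : Type _) :=
  Equiv.ofBijective _ (hS.param_bijective hLT)

/-! ### Gaussian masses along the parametrisation -/

/-- **`ρ(M) = ∑_{x ∈ S} ρ(x + L)²`** (`= Z²`, the squared norm of `ϑ₂`): `ρ((x + y₁, x + y₂)) =
ρ(x + y₁) ρ(x + y₂)` on the `ℓ₂` product, summed along `S × L × L ≃ M`.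
[cite: Regev2009, Claim 3.13 (proof: "ρ(M) = ∑ ρ(x + L)² = Z²")] -/
theorem gaussianMass_couplingLattice_eq (hLT : L ≤ T) (s : ℝ) :
    gaussianMass s 0 (couplingLattice T L : Set (WithLp 2 (V × V))) =
      ∑ x ∈ S, gaussianMass s (-x) (L : Set V) ^ 2 := by
  -- reindex along the parametrisation
  have h1 : gaussianMass s 0 (couplingLattice T L : Set (WithLp 2 (V × V))) =
      ∑' q : S × L × L, ENNReal.ofReal (gaussianFunction s ((q.1 : V) + q.2.1)) *
        ENNReal.ofReal (gaussianFunction s ((q.1 : V) + q.2.2)) := by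
    unfold gaussianMass
    rw [← (hS.paramEquiv hLT).tsum_eq]
    refine tsum_congr fun q => ?_
    rw [sub_zero, ← ENNReal.ofReal_mul (gaussianFunction_pos _ _).le]
    congr 1
    change gaussianFunction s (WithLp.toLp 2 ((q.1 : V) + q.2.1, (q.1 : V) + q.2.2)) = _
    rw [gaussianFunction_prod]
    rfl
  rw [h1, ENNReal.tsum_prod', tsum_fintype, Finset.sum_coe_sort S (fun x => ∑' c : ↥L × ↥L,
    ENNReal.ofReal (gaussianFunction s (x + c.1)) * ENNReal.ofReal (gaussianFunction s (x + c.2)))]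
  refine Finset.sum_congr rfl fun x _ => ?_
  rw [ENNReal.tsum_prod', sq, gaussianMass_submodule, ← ENNReal.tsum_mul_right]
  refine tsum_congr fun y1 => ?_
  rw [← ENNReal.tsum_mul_left]
  refine tsum_congr fun y2 => ?_
  simp only [sub_neg_eq_add, add_comm (x : V)]

/-- **`‖ϑ₂ - ϑ₁‖² ≤ ρ(M ∖ √2·a B)`**: the sum over `S` of the squared tail masses
`ρ((x + L) ∖ B(0,a))²` is the mass of the pairs of `M` with both coordinates of norm `≥ a`, which
lie outside the open ball of radius `√2·a`. [cite: Regev2009, Claim 3.13 (proof: "‖ϑ₂ − ϑ₁‖² = ρ(M′)", "M′ ⊂ M ∖ √(2n)Bₙ")] -/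
theorem sum_sq_tailMass_le_gaussianMass_diff_ball (hLT : L ≤ T) (s : ℝ) {a : ℝ} (ha : 0 ≤ a) :
    ∑ x ∈ S, gaussianMass s (-x) ((L : Set V) \ ball (-x) a) ^ 2 ≤
      gaussianMass s 0 ((couplingLattice T L : Set (WithLp 2 (V × V))) \ ball 0 (Real.sqrt 2 * a)) := by
  classical
  -- the tail mass at `x` as an indicator sum over `L`
  have htail : ∀ x : V, gaussianMass s (-x) ((L : Set V) \ ball (-x) a) =
      ∑' y : L, if a ≤ ‖x + (y : V)‖ then ENNReal.ofReal (gaussianFunction s (x + y)) else 0 := by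
    intro x
    rw [Set.sdiff_eq_compl_inter, Set.inter_comm, gaussianMass_inter_eq_tsum_indicator]
    refine tsum_congr fun y => ?_
    simp only [Set.indicator, Set.mem_compl_iff, Metric.mem_ball, dist_eq_norm, sub_neg_eq_add, not_lt,
      add_comm (x : V)]
  -- the right side as an indicator sum over `M`, reindexed
  have hR : gaussianMass s 0 ((couplingLattice T L : Set (WithLp 2 (V × V))) \ ball 0 (Real.sqrt 2 * a)) =
      ∑' q : S × L × L, if Real.sqrt 2 * a ≤ ‖WithLp.toLp 2 ((q.1 : V) + q.2.1, (q.1 : V) + q.2.2)‖ then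
        ENNReal.ofReal (gaussianFunction s ((q.1 : V) + q.2.1)) * ENNReal.ofReal (gaussianFunction s ((q.1 : V) + q.2.2))
        else 0 := by
    rw [Set.sdiff_eq_compl_inter, Set.inter_comm, gaussianMass_inter_eq_tsum_indicator,
      show (∑' y : couplingLattice T L, (ball (0 : WithLp 2 (V × V)) (Real.sqrt 2 * a))ᶜ.indicator
          (fun w => ENNReal.ofReal (gaussianFunction s (w - 0))) y) =
        ∑' y : ((couplingLattice T L : Set (WithLp 2 (V × V))) : Type _),
          (ball (0 : WithLp 2 (V × V)) (Real.sqrt 2 * a))ᶜ.indicator (fun w => ENNReal.ofReal (gaussianFunction s (w - 0))) y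
        from rfl,
      ← (hS.paramEquiv hLT).tsum_eq]
    refine tsum_congr fun q => ?_
    change (ball (0 : WithLp 2 (V × V)) (Real.sqrt 2 * a))ᶜ.indicator _ (WithLp.toLp 2 ((q.1 : V) + q.2.1, (q.1 : V) + q.2.2)) = _
    simp only [Set.indicator, Set.mem_compl_iff, Metric.mem_ball, dist_zero_right, not_lt, sub_zero]
    split_ifs with h
    · rw [← ENNReal.ofReal_mul (gaussianFunction_pos _ _).le, gaussianFunction_prod]; rfl
    · rfl
  rw [hR, ENNReal.tsum_prod', tsum_fintype, Finset.sum_coe_sort S (fun x => ∑' c : ↥L × ↥L,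
    if Real.sqrt 2 * a ≤ ‖WithLp.toLp 2 (x + (c.1 : V), x + (c.2 : V))‖ then
      ENNReal.ofReal (gaussianFunction s (x + c.1)) * ENNReal.ofReal (gaussianFunction s (x + c.2)) else 0)]
  refine Finset.sum_le_sum fun x _ => ?_
  rw [htail x, sq, ← ENNReal.tsum_mul_right, ENNReal.tsum_prod']
  refine ENNReal.tsum_le_tsum fun y1 => ?_
  rw [← ENNReal.tsum_mul_left]
  refine ENNReal.tsum_le_tsum fun y2 => ?_
  by_cases h1 : a ≤ ‖x + (y1 : V)‖
  · by_cases h2 : a ≤ ‖x + (y2 : V)‖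
    · rw [if_pos h1, if_pos h2, if_pos]
      exact sqrt_two_mul_le_norm_of_le ha _ (by simpa using h1) (by simpa using h2)
    · rw [if_neg h2, mul_zero]; exact zero_le
  · rw [if_neg h1, zero_mul]; exact zero_le

end IsTransversal

/-! ### Claim 3.13 -/

section Claim

variable {E : Type*} [NormedAddCommGroup E] [InnerProductSpace ℝ E] [FiniteDimensional ℝ E]
  {T L : Submodule ℤ E} [DiscreteTopology T] [DiscreteTopology L] [IsZLattice ℝ L]

/-- The dimension of the `ℓ₂` product is `2n`. [folklore] -/
theorem finrank_withLp_prod : finrank ℝ (WithLp 2 (E × E)) = 2 * finrank ℝ E := by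
  rw [(WithLp.linearEquiv 2 ℝ (E × E)).finrank_eq, Module.finrank_prod]; ring

/-- **Regev 2009, Claim 3.13 (Gaussian-mass form).** For full-rank lattices `L ≤ T` of an
`n`-dimensional space and a finite transversal `S` of `T/L`:
`∑_{x ∈ S} ρ((x + L) ∖ √n B)² ≤ 2^{-2n} · ∑_{x ∈ S} ρ(x + L)²`, i.e. `‖ϑ₂ - ϑ₁‖² ≤ 2^{-2n} ‖ϑ₂‖²`
for the coefficient vectors `ϑ₂(x) = ρ(x + L)`, `(ϑ₂ - ϑ₁)(x) = ρ((x + L) ∖ √n B)` of the two states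
(here `ρ = ρ₁`; `ϑ₁` keeps the points of norm `< √n`, so the difference is the mass of the points of
norm `≥ √n`, the complement of the open ball). Proof as printed: both sides are Gaussian masses of the
`2n`-dimensional coupling lattice `M` (`gaussianMass_couplingLattice_eq`,
`sum_sq_tailMass_le_gaussianMass_diff_ball` with `√2 · √n = √(2n)`), and Banaszczyk's Lemma 2.5 in
dimension `2n` (`gaussianMass_diff_ball_le_holds`). [cite: Regev2009, Claim 3.13] -/
theorem claim_3_13 (hLT : L ≤ T) {S : Finset E} (hS : IsTransversal T L S) :
    ∑ x ∈ S, gaussianMass 1 (-x) ((L : Set E) \ ball (-x) (Real.sqrt (finrank ℝ E))) ^ 2 ≤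
      (2⁻¹ : ℝ≥0∞) ^ (2 * finrank ℝ E) * ∑ x ∈ S, gaussianMass 1 (-x) (L : Set E) ^ 2 := by
  haveI : Fact (L ≤ T) := ⟨hLT⟩
  have hB := gaussianMass_diff_ball_le_holds (couplingLattice T L) one_pos
  rw [one_mul, finrank_withLp_prod, hS.gaussianMass_couplingLattice_eq hLT 1] at hB
  refine le_trans ?_ hB
  have hsqrt : Real.sqrt ((2 * finrank ℝ E : ℕ) : ℝ) = Real.sqrt 2 * Real.sqrt (finrank ℝ E) := by
    rw [Nat.cast_mul, Nat.cast_ofNat, Real.sqrt_mul zero_le_two]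
  rw [hsqrt]
  exact hS.sum_sq_tailMass_le_gaussianMass_diff_ball hLT 1 (Real.sqrt_nonneg _)

/-- **Regev 2009, Claim 3.13 (`ℓ₂` form).** With the real coefficient vectors
`ϑ₂(x) = ρ(x + L)` and `δ(x) = ρ((x + L) ∖ √n B) = ϑ₂(x) - ϑ₁(x)` indexed by the transversal `S`:
`√(∑ δ(x)²) ≤ 2⁻ⁿ √(∑ ϑ₂(x)²)`, i.e. `‖ϑ₂ - ϑ₁‖ ≤ 2⁻ⁿ ‖ϑ₂‖`; the distance between the NORMALISED
states is then at most `2 · 2⁻ⁿ` by the triangle inequality. [cite: Regev2009, Claim 3.13] -/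
theorem claim_3_13_real (hLT : L ≤ T) {S : Finset E} (hS : IsTransversal T L S) :
    Real.sqrt (∑ x ∈ S, (gaussianMass 1 (-x) ((L : Set E) \ ball (-x) (Real.sqrt (finrank ℝ E)))).toReal ^ 2) ≤
      (2⁻¹ : ℝ) ^ finrank ℝ E * Real.sqrt (∑ x ∈ S, (gaussianMass 1 (-x) (L : Set E)).toReal ^ 2) := by
  have h := claim_3_13 hLT hS
  -- all masses are finite
  have hfin : ∀ x : E, gaussianMass 1 (-x) (L : Set E) ≠ ⊤ := fun x => gaussianMass_lattice_ne_top L one_ne_zero _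
  have hfin' : ∀ x : E, gaussianMass 1 (-x) ((L : Set E) \ ball (-x) (Real.sqrt (finrank ℝ E))) ≠ ⊤ := fun x =>
    ne_top_of_le_ne_top (hfin x) (gaussianMass_mono _ _ Set.sdiff_subset)
  -- pass to reals
  have hcB : (2⁻¹ : ℝ≥0∞) ^ (2 * finrank ℝ E) * ∑ x ∈ S, gaussianMass 1 (-x) (L : Set E) ^ 2 ≠ ⊤ :=
    ENNReal.mul_ne_top (ENNReal.pow_ne_top (by simp))
      (ENNReal.sum_ne_top.2 fun x _ => ENNReal.pow_ne_top (hfin x))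
  have hr := ENNReal.toReal_mono hcB h
  rw [ENNReal.toReal_sum (fun x _ => ENNReal.pow_ne_top (hfin' x)), ENNReal.toReal_mul, ENNReal.toReal_pow,
    ENNReal.toReal_inv, ENNReal.toReal_ofNat, ENNReal.toReal_sum (fun x _ => ENNReal.pow_ne_top (hfin x))] at hr
  simp only [ENNReal.toReal_pow] at hr
  calc Real.sqrt (∑ x ∈ S, (gaussianMass 1 (-x) ((L : Set E) \ ball (-x) (Real.sqrt (finrank ℝ E)))).toReal ^ 2)
      ≤ Real.sqrt ((2⁻¹ : ℝ) ^ (2 * finrank ℝ E) * ∑ x ∈ S, (gaussianMass 1 (-x) (L : Set E)).toReal ^ 2) :=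
        Real.sqrt_le_sqrt hr
    _ = (2⁻¹ : ℝ) ^ finrank ℝ E * Real.sqrt (∑ x ∈ S, (gaussianMass 1 (-x) (L : Set E)).toReal ^ 2) := by
        rw [Real.sqrt_mul (by positivity), pow_mul', Real.sqrt_sq (by positivity)]

end Claim

end Regev2009

end Literature.Algebra.EuclideanLattices

end
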